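import Literature.AlgebraicGeometry.ModuliOfAbelianVarieties.SiegelFamilyRealBlockDiagonalNormalForm
import HarnessLib

/-!
# The `Γ(2^k)` normal form of a real boundary pair: Goresky–Tai 2003, Lemma 27 and Theorem 28,
# the algebra of §10.2–§10.3 (with §8.4) assembled at matrix level

Goresky–Tai, *The moduli space of real abelian varieties with level structure*, Compositio Math. **139** (2003)
= arXiv:math/0108103 (held `paper:arxiv-math_0108103`), §10 p0018, print (verbatim):

> «**Lemma 27.** Let `(F, γ)` be a real boundary pair of rank `q`.  Then there exists `r ≥ q`, there exists
> `γ′ ∈ Γ(2^k)` and there exists `g ∈ Sp(2n, ℤ)` such that `F^γ = F^{γ′}`, `gF_q = F`, `g̃⁻¹γ′g ∈ ker(ν)`, and so that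
> `g̃⁻¹γ′g ≡ (I_r 0 0 0; 0 −I_s 0 0; 0 0 I_r 0; 0 0 0 −I_s) mod 2^k` (10.2) where `s = n − r`.»
> «*Proof.* By Proposition 23 there exists `γ′ ∈ Γ(2^k)` and there exists `a ∈ Sp(2n, ℤ)` so that `F^γ = F^{γ′}`,
> `aF_q = F`, and `u = ã⁻¹γ′a = (A 0; 0 ᵗA⁻¹) ∈ ker(ν)`.  Then `γ̃′γ′ = au²a⁻¹ ∈ Γ(2^{k+1})` by Lemma 9, hence
> `A² ≡ I mod 2^{k+1}`.  Moreover, `A ∈ Γ(2)` and `A = (I_q 0; * *)`.  Let `p ∈ GL(n, ℤ)` be the change of basis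
> provided by Lemma 26.  Then `p⁻¹Ap = (I_q 0; * *)` and (after re-ordering the coordinates if necessary),
> `p⁻¹Ap ≡ (I_r 0; 0 −I_s) mod 2^k` for some `r ≥ q`.  Set `h = (p 0; 0 ᵗp⁻¹) ∈ ker(ν)`.  Set `g = ah`. … Then
> `h̃⁻¹uh = g̃⁻¹γ′g ∈ ker(ν)` and `g̃⁻¹γ′g` has the desired form (10.2).»
> «**Theorem 28.** Let `(F, γ)` be a real boundary pair.  Then there exists `γ₁ ∈ Γ(2^k)` so that the set
> `F^γ = F^{γ₁}` of `γ`-real points is contained in the closure `\overline{𝔥_n^{γ₁}}`.»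
> «*Proof.* Set `q = rank(F)`.  By Lemma 27, there exists `γ₁ ∈ Γ(2^k)` and there exists `g ∈ Sp(2n, ℤ)` so that
> `F^γ = F^{γ₁}`, so that `g(F_{n−1}) = F` and so that `u = g̃⁻¹γ₁g` lies in `ker(ν)` and has the form (10.2), for some
> `r ≥ q`.  Therefore `j_ruj_r ≡ I mod 2^k` so Proposition 24 may be applied.»

and §8.4 p0015 (proof of Proposition 24): «`ω = τ(gj_r)(gj_r)⁻¹ = γ((gj_r)(j_ruj_r)⁻¹(gj_r)⁻¹) ∈ Γ(4m)`».

## What is formalized (the group-theoretic skeleton; `Sp = Matrix.symplecticGroup (Fin g) ℤ`, `τ(x) = KxK`,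
## `K = (−1 0; 0 1)`, `Γ_g(N) = siegelPrincipalGamma g N`)

The INGREDIENTS are in the tree: Lemma 26 and the core of §10.2 (`SiegelFamilyRealBlockDiagonalNormalForm`:
`exists_blockDiagonal_inv_mul_mul_map_eq_of_mem_siegelPrincipalGamma`, under the hypotheses `u ∈ Γ_g(2)`,
`u² ∈ Γ_g(2^{k+1})`), the Theorem-28 step `jSign_mul_mul_jSign_mem_siegelPrincipalGamma`, Proposition 24's identity
`iStarConj_mul_inv_eq_and_mem_siegelPrincipalGamma`, Lemma 9 (1)–(2) (`SiegelFamilyRealPointsLevelTwo`).  This file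
DERIVES the two hypotheses from `γ′ ∈ Γ_g(2^k)` exactly as printed and chains everything:

* §1 `conjK_mk_conjK_mk` (`ττ = 1`), `conjK_mk_eq_self_of_toBlocks_eq_zero` (`τ(h) = h` for block-diagonal `h`),
  `conjK_mk_mul_self_of_eq_conjK_inv_mul_mul` («`γ̃′γ′ = au²a⁻¹`»: `τ(u)u = a⁻¹(γ̃′γ′)a` for `u = τ(a)⁻¹γ′a`),
  `conjK_inv_mul_mul_mem_siegelPrincipalGamma_two` («Moreover, `A ∈ Γ(2)`»: `u ∈ Γ_g(2)`, via Lemma 9 (1) with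
  `m = 1` and normality), `conjK_mk_mul_self_mem_siegelPrincipalGamma_of_eq_conjK_inv_mul_mul` /
  `mul_self_mem_siegelPrincipalGamma_of_eq_conjK_inv_mul_mul` (`γ′ ∈ Γ_g(2m)` ⟹ `τ(u)u`, resp. `u²` for
  block-diagonal `u`, lies in `Γ_g(4m)` — Lemma 9 (2));
* §2 ★ `exists_blockDiagonal_conjK_inv_mul_mul_map_eq_of_mem_siegelPrincipalGamma` — LEMMA 27 assembled: for
  `k ≥ 1`, `γ′ ∈ Γ_g(2^k)`, `a ∈ Sp` with `u = τ(a)⁻¹γ′a` block-diagonal with identity rows on `S`, there are a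
  block-diagonal `h` (`τ(h) = h`, identity rows on `S`) and `ε ∈ {±1}^g` (`= 1` on `S`) with
  `τ(ah)⁻¹γ′(ah) = h⁻¹uh ≡ (diag ε 0; 0 diag ε) (mod 2^k)`;
* §3 `conjK_mk_jSign_eq_inv` (`τ(j) = j⁻¹` in the group), ★
  `exists_blockDiagonal_jSign_conj_mem_and_cocycle_mem_siegelPrincipalGamma` — THEOREM 28's algebra: in addition
  `j(ε)·(τ(g)⁻¹γ′g)·j(ε) ∈ Γ_g(2^k)` (`g = ah`), and with `ω = τ(gj)(gj)⁻¹`: `ω = γ′·((gj)(j(τ(g)⁻¹γ′g)j)⁻¹(gj)⁻¹)`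
  and `ω ∈ Γ_g(2^k)`.

Scope: the boundary-component statements (`F^γ = F^{γ′}`, `gF_q = F`, `F^{γ′} ⊂ \overline{𝔥^{ω}}`; Propositions 22–24
as statements about the Satake topology) are NOT formalized; GT's re-ordering of the coordinates to
`diag(I_r, −I_s, I_r, −I_s)` with `r ≥ q` is a permutation, not asserted (the sign pattern `ε` with `ε|S = 1` carries the
same information).  THEOREMS ONLY; no definition, instance, notation or named fact.

## References

* [GoreskyTai2003RealModuli] M. Goresky, Y. S. Tai, Compositio Math. **139** (2003) 1–27 = arXiv:math/0108103, §4 Lemma 9,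
  §8.3–§8.4 (Proposition 24), §10.1–§10.3 (Lemma 26, Lemma 27, Theorem 28).
-/

noncomputable section

open scoped Matrix
open Matrix Function

namespace Literature.AlgebraicGeometry.ModuliOfAbelianVarieties

namespace SiegelModuli

open Literature.NumberTheory.ModularForms.SiegelModularForm (siegelPrincipalGamma mem_siegelPrincipalGamma_iff
  normal_siegelPrincipalGamma siegelPrincipalGamma_anti)

variable {g : ℕ}

/-! ## §1 `τ` on `Sp_{2g}(ℤ)`: `τ ∘ τ = 1`, `τ` fixes block-diagonal matrices; `u = τ(a)⁻¹γa` -/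

section Tau

/-- **`τ(τ(x)) = x` in `Sp_{2g}(ℤ)`** (`K² = 1`). [cite: GoreskyTai2003RealModuli, §2.2 («`τ` is an involution of `G`»)] -/
theorem conjK_mk_conjK_mk (x : Matrix.symplecticGroup (Fin g) ℤ) : (⟨fromBlocks (-1 : Matrix (Fin g) (Fin g) ℤ) 0 0 (1 : Matrix (Fin g) (Fin g) ℤ) *
          (((⟨fromBlocks (-1 : Matrix (Fin g) (Fin g) ℤ) 0 0 (1 : Matrix (Fin g) (Fin g) ℤ) *
          ((x : Matrix.symplecticGroup (Fin g) ℤ) : Matrix (Fin g ⊕ Fin g) (Fin g ⊕ Fin g) ℤ) *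
          fromBlocks (-1 : Matrix (Fin g) (Fin g) ℤ) 0 0 (1 : Matrix (Fin g) (Fin g) ℤ),
        iStar_mul_mul_iStar_mem_symplecticGroup (x).2⟩ : Matrix.symplecticGroup (Fin g) ℤ) : Matrix.symplecticGroup (Fin g) ℤ) : Matrix (Fin g ⊕ Fin g) (Fin g ⊕ Fin g) ℤ) *
          fromBlocks (-1 : Matrix (Fin g) (Fin g) ℤ) 0 0 (1 : Matrix (Fin g) (Fin g) ℤ),
        iStar_mul_mul_iStar_mem_symplecticGroup ((⟨fromBlocks (-1 : Matrix (Fin g) (Fin g) ℤ) 0 0 (1 : Matrix (Fin g) (Fin g) ℤ) *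
          ((x : Matrix.symplecticGroup (Fin g) ℤ) : Matrix (Fin g ⊕ Fin g) (Fin g ⊕ Fin g) ℤ) *
          fromBlocks (-1 : Matrix (Fin g) (Fin g) ℤ) 0 0 (1 : Matrix (Fin g) (Fin g) ℤ),
        iStar_mul_mul_iStar_mem_symplecticGroup (x).2⟩ : Matrix.symplecticGroup (Fin g) ℤ)).2⟩ : Matrix.symplecticGroup (Fin g) ℤ) = x :=
  Subtype.ext (iStar_mul_mul_iStar_involutive _)

/-- **`τ(h) = h` for block-diagonal `h ∈ Sp_{2g}(ℤ)`** («`τ(g) = g ⟺ g ∈ GL(n)`», the image `(A 0; 0 ᵗA⁻¹)` of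
`GL_n(ℤ)`, i.e. `ker(ν) ∩ (P 0; 0 Q)`-shaped elements). [cite: GoreskyTai2003RealModuli, §2.2 («`τ(g) = g ⟺ g ∈ GL(n, ℝ)`»)] -/
theorem conjK_mk_eq_self_of_toBlocks_eq_zero (x : Matrix.symplecticGroup (Fin g) ℤ)
    (h₁₂ : (x : Matrix (Fin g ⊕ Fin g) (Fin g ⊕ Fin g) ℤ).toBlocks₁₂ = 0) (h₂₁ : (x : Matrix (Fin g ⊕ Fin g) (Fin g ⊕ Fin g) ℤ).toBlocks₂₁ = 0) : (⟨fromBlocks (-1 : Matrix (Fin g) (Fin g) ℤ) 0 0 (1 : Matrix (Fin g) (Fin g) ℤ) *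
          ((x : Matrix.symplecticGroup (Fin g) ℤ) : Matrix (Fin g ⊕ Fin g) (Fin g ⊕ Fin g) ℤ) *
          fromBlocks (-1 : Matrix (Fin g) (Fin g) ℤ) 0 0 (1 : Matrix (Fin g) (Fin g) ℤ),
        iStar_mul_mul_iStar_mem_symplecticGroup (x).2⟩ : Matrix.symplecticGroup (Fin g) ℤ) = x :=
  Subtype.ext ((conjK_mul_mul_conjK_eq_self_iff _).2 ⟨h₁₂, h₂₁⟩)

/-- **«`γ̃′γ′ = au²a⁻¹`»**, the identity behind it: for `u = τ(a)⁻¹γ′a` one has `τ(u)u = a⁻¹(τ(γ′)γ′)a` in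
`Sp_{2g}(ℤ)` (for `u ∈ ker(ν)` block-diagonal, `τ(u) = u` and this reads `u² = a⁻¹γ̃′γ′a`).
[cite: GoreskyTai2003RealModuli, §10.2 (proof of Lemma 27: «Then `γ̃′γ′ = au²a⁻¹ ∈ Γ(2^{k+1})`»)] -/
theorem conjK_mk_mul_self_of_eq_conjK_inv_mul_mul (γ a : Matrix.symplecticGroup (Fin g) ℤ) :
    (⟨fromBlocks (-1 : Matrix (Fin g) (Fin g) ℤ) 0 0 (1 : Matrix (Fin g) (Fin g) ℤ) *
          (((⟨fromBlocks (-1 : Matrix (Fin g) (Fin g) ℤ) 0 0 (1 : Matrix (Fin g) (Fin g) ℤ) *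
          ((a : Matrix.symplecticGroup (Fin g) ℤ) : Matrix (Fin g ⊕ Fin g) (Fin g ⊕ Fin g) ℤ) *
          fromBlocks (-1 : Matrix (Fin g) (Fin g) ℤ) 0 0 (1 : Matrix (Fin g) (Fin g) ℤ),
        iStar_mul_mul_iStar_mem_symplecticGroup (a).2⟩ : Matrix.symplecticGroup (Fin g) ℤ)⁻¹ * γ * a : Matrix.symplecticGroup (Fin g) ℤ) : Matrix (Fin g ⊕ Fin g) (Fin g ⊕ Fin g) ℤ) *
          fromBlocks (-1 : Matrix (Fin g) (Fin g) ℤ) 0 0 (1 : Matrix (Fin g) (Fin g) ℤ),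
        iStar_mul_mul_iStar_mem_symplecticGroup ((⟨fromBlocks (-1 : Matrix (Fin g) (Fin g) ℤ) 0 0 (1 : Matrix (Fin g) (Fin g) ℤ) *
          ((a : Matrix.symplecticGroup (Fin g) ℤ) : Matrix (Fin g ⊕ Fin g) (Fin g ⊕ Fin g) ℤ) *
          fromBlocks (-1 : Matrix (Fin g) (Fin g) ℤ) 0 0 (1 : Matrix (Fin g) (Fin g) ℤ),
        iStar_mul_mul_iStar_mem_symplecticGroup (a).2⟩ : Matrix.symplecticGroup (Fin g) ℤ)⁻¹ * γ * a).2⟩ : Matrix.symplecticGroup (Fin g) ℤ) * ((⟨fromBlocks (-1 : Matrix (Fin g) (Fin g) ℤ) 0 0 (1 : Matrix (Fin g) (Fin g) ℤ) *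
          ((a : Matrix.symplecticGroup (Fin g) ℤ) : Matrix (Fin g ⊕ Fin g) (Fin g ⊕ Fin g) ℤ) *
          fromBlocks (-1 : Matrix (Fin g) (Fin g) ℤ) 0 0 (1 : Matrix (Fin g) (Fin g) ℤ),
        iStar_mul_mul_iStar_mem_symplecticGroup (a).2⟩ : Matrix.symplecticGroup (Fin g) ℤ)⁻¹ * γ * a) = a⁻¹ * ((⟨fromBlocks (-1 : Matrix (Fin g) (Fin g) ℤ) 0 0 (1 : Matrix (Fin g) (Fin g) ℤ) *
          ((γ : Matrix.symplecticGroup (Fin g) ℤ) : Matrix (Fin g ⊕ Fin g) (Fin g ⊕ Fin g) ℤ) *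
          fromBlocks (-1 : Matrix (Fin g) (Fin g) ℤ) 0 0 (1 : Matrix (Fin g) (Fin g) ℤ),
        iStar_mul_mul_iStar_mem_symplecticGroup (γ).2⟩ : Matrix.symplecticGroup (Fin g) ℤ) * γ) * a := by
  rw [conjK_mk_mul, conjK_mk_mul, conjK_mk_inv, conjK_mk_conjK_mk]
  group

/-- **«Moreover, `A ∈ Γ(2)`»**: for `γ′ ∈ Γ_g(2)` and any `a ∈ Sp_{2g}(ℤ)`, `u = τ(a)⁻¹γ′a ∈ Γ_g(2)` — because
`τ(a) ≡ a (mod 2)` (`K ≡ I`), i.e. `τ(a)a⁻¹ ∈ Γ_g(2)` (Lemma 9 (1) with `m = 1`) and `Γ_g(2)` is normal.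
[cite: GoreskyTai2003RealModuli, §10.2 (proof of Lemma 27: «Moreover, `A ∈ Γ(2)`») with §4 Lemma 9 (1)] -/
theorem conjK_inv_mul_mul_mem_siegelPrincipalGamma_two {γ : Matrix.symplecticGroup (Fin g) ℤ}
    (hγ : γ ∈ siegelPrincipalGamma g 2) (a : Matrix.symplecticGroup (Fin g) ℤ) :
    (⟨fromBlocks (-1 : Matrix (Fin g) (Fin g) ℤ) 0 0 (1 : Matrix (Fin g) (Fin g) ℤ) *
          ((a : Matrix.symplecticGroup (Fin g) ℤ) : Matrix (Fin g ⊕ Fin g) (Fin g ⊕ Fin g) ℤ) *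
          fromBlocks (-1 : Matrix (Fin g) (Fin g) ℤ) 0 0 (1 : Matrix (Fin g) (Fin g) ℤ),
        iStar_mul_mul_iStar_mem_symplecticGroup (a).2⟩ : Matrix.symplecticGroup (Fin g) ℤ)⁻¹ * γ * a ∈ siegelPrincipalGamma g 2 := by
  have h1 : a ∈ siegelPrincipalGamma g 1 :=
    mem_siegelPrincipalGamma_iff_dvd.2 fun i j => by rw [Nat.cast_one]; exact one_dvd _
  have h91 : (⟨fromBlocks (-1 : Matrix (Fin g) (Fin g) ℤ) 0 0 (1 : Matrix (Fin g) (Fin g) ℤ) *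
          ((a : Matrix.symplecticGroup (Fin g) ℤ) : Matrix (Fin g ⊕ Fin g) (Fin g ⊕ Fin g) ℤ) *
          fromBlocks (-1 : Matrix (Fin g) (Fin g) ℤ) 0 0 (1 : Matrix (Fin g) (Fin g) ℤ),
        iStar_mul_mul_iStar_mem_symplecticGroup (a).2⟩ : Matrix.symplecticGroup (Fin g) ℤ) * a⁻¹ ∈ siegelPrincipalGamma g 2 := by
    simpa only [Nat.mul_one] using conjK_mul_inv_mem_siegelPrincipalGamma h1
  have hn : ((⟨fromBlocks (-1 : Matrix (Fin g) (Fin g) ℤ) 0 0 (1 : Matrix (Fin g) (Fin g) ℤ) *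
          ((a : Matrix.symplecticGroup (Fin g) ℤ) : Matrix (Fin g ⊕ Fin g) (Fin g ⊕ Fin g) ℤ) *
          fromBlocks (-1 : Matrix (Fin g) (Fin g) ℤ) 0 0 (1 : Matrix (Fin g) (Fin g) ℤ),
        iStar_mul_mul_iStar_mem_symplecticGroup (a).2⟩ : Matrix.symplecticGroup (Fin g) ℤ) * a⁻¹)⁻¹ * γ ∈ siegelPrincipalGamma g 2 :=
    (siegelPrincipalGamma g 2).mul_mem ((siegelPrincipalGamma g 2).inv_mem h91) hγ
  have hc := (normal_siegelPrincipalGamma (n := g) (q := 2)).conj_mem _ hn a⁻¹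
  rw [inv_inv] at hc
  have e : (⟨fromBlocks (-1 : Matrix (Fin g) (Fin g) ℤ) 0 0 (1 : Matrix (Fin g) (Fin g) ℤ) *
          ((a : Matrix.symplecticGroup (Fin g) ℤ) : Matrix (Fin g ⊕ Fin g) (Fin g ⊕ Fin g) ℤ) *
          fromBlocks (-1 : Matrix (Fin g) (Fin g) ℤ) 0 0 (1 : Matrix (Fin g) (Fin g) ℤ),
        iStar_mul_mul_iStar_mem_symplecticGroup (a).2⟩ : Matrix.symplecticGroup (Fin g) ℤ)⁻¹ * γ * a = a⁻¹ * (((⟨fromBlocks (-1 : Matrix (Fin g) (Fin g) ℤ) 0 0 (1 : Matrix (Fin g) (Fin g) ℤ) *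
          ((a : Matrix.symplecticGroup (Fin g) ℤ) : Matrix (Fin g ⊕ Fin g) (Fin g ⊕ Fin g) ℤ) *
          fromBlocks (-1 : Matrix (Fin g) (Fin g) ℤ) 0 0 (1 : Matrix (Fin g) (Fin g) ℤ),
        iStar_mul_mul_iStar_mem_symplecticGroup (a).2⟩ : Matrix.symplecticGroup (Fin g) ℤ) * a⁻¹)⁻¹ * γ) * a := by group
  rw [e]
  exact hc

/-- **«`γ̃′γ′ = au²a⁻¹ ∈ Γ(2^{k+1})` by Lemma 9»**, in general level: for `γ′ ∈ Γ_g(2m)` and `u = τ(a)⁻¹γ′a`,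
`τ(u)u = a⁻¹(γ̃′γ′)a ∈ Γ_g(4m)` (Lemma 9 (2): `γ̃′γ′ ∈ Γ_g(4m)`; normality).
[cite: GoreskyTai2003RealModuli, §10.2 (proof of Lemma 27) with §4 Lemma 9 (2)] -/
theorem conjK_mk_mul_self_mem_siegelPrincipalGamma_of_eq_conjK_inv_mul_mul {m : ℕ} {γ : Matrix.symplecticGroup (Fin g) ℤ}
    (hγ : γ ∈ siegelPrincipalGamma g (2 * m)) (a : Matrix.symplecticGroup (Fin g) ℤ) :
    (⟨fromBlocks (-1 : Matrix (Fin g) (Fin g) ℤ) 0 0 (1 : Matrix (Fin g) (Fin g) ℤ) *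
          (((⟨fromBlocks (-1 : Matrix (Fin g) (Fin g) ℤ) 0 0 (1 : Matrix (Fin g) (Fin g) ℤ) *
          ((a : Matrix.symplecticGroup (Fin g) ℤ) : Matrix (Fin g ⊕ Fin g) (Fin g ⊕ Fin g) ℤ) *
          fromBlocks (-1 : Matrix (Fin g) (Fin g) ℤ) 0 0 (1 : Matrix (Fin g) (Fin g) ℤ),
        iStar_mul_mul_iStar_mem_symplecticGroup (a).2⟩ : Matrix.symplecticGroup (Fin g) ℤ)⁻¹ * γ * a : Matrix.symplecticGroup (Fin g) ℤ) : Matrix (Fin g ⊕ Fin g) (Fin g ⊕ Fin g) ℤ) *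
          fromBlocks (-1 : Matrix (Fin g) (Fin g) ℤ) 0 0 (1 : Matrix (Fin g) (Fin g) ℤ),
        iStar_mul_mul_iStar_mem_symplecticGroup ((⟨fromBlocks (-1 : Matrix (Fin g) (Fin g) ℤ) 0 0 (1 : Matrix (Fin g) (Fin g) ℤ) *
          ((a : Matrix.symplecticGroup (Fin g) ℤ) : Matrix (Fin g ⊕ Fin g) (Fin g ⊕ Fin g) ℤ) *
          fromBlocks (-1 : Matrix (Fin g) (Fin g) ℤ) 0 0 (1 : Matrix (Fin g) (Fin g) ℤ),
        iStar_mul_mul_iStar_mem_symplecticGroup (a).2⟩ : Matrix.symplecticGroup (Fin g) ℤ)⁻¹ * γ * a).2⟩ : Matrix.symplecticGroup (Fin g) ℤ) * ((⟨fromBlocks (-1 : Matrix (Fin g) (Fin g) ℤ) 0 0 (1 : Matrix (Fin g) (Fin g) ℤ) *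
          ((a : Matrix.symplecticGroup (Fin g) ℤ) : Matrix (Fin g ⊕ Fin g) (Fin g ⊕ Fin g) ℤ) *
          fromBlocks (-1 : Matrix (Fin g) (Fin g) ℤ) 0 0 (1 : Matrix (Fin g) (Fin g) ℤ),
        iStar_mul_mul_iStar_mem_symplecticGroup (a).2⟩ : Matrix.symplecticGroup (Fin g) ℤ)⁻¹ * γ * a) ∈ siegelPrincipalGamma g (4 * m) := by
  rw [conjK_mk_mul_self_of_eq_conjK_inv_mul_mul]
  have hc := (normal_siegelPrincipalGamma (n := g) (q := 4 * m)).conj_mem _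
    (conjK_mul_self_mem_siegelPrincipalGamma hγ) a⁻¹
  rwa [inv_inv] at hc

/-- **… hence `u² ∈ Γ_g(4m)` when `u = τ(a)⁻¹γ′a` is block-diagonal** («hence `A² ≡ I mod 2^{k+1}`»).
[cite: GoreskyTai2003RealModuli, §10.2 (proof of Lemma 27)] -/
theorem mul_self_mem_siegelPrincipalGamma_of_eq_conjK_inv_mul_mul {m : ℕ} {γ : Matrix.symplecticGroup (Fin g) ℤ}
    (hγ : γ ∈ siegelPrincipalGamma g (2 * m)) (a : Matrix.symplecticGroup (Fin g) ℤ)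
    (hu₁₂ : (((⟨fromBlocks (-1 : Matrix (Fin g) (Fin g) ℤ) 0 0 (1 : Matrix (Fin g) (Fin g) ℤ) *
          ((a : Matrix.symplecticGroup (Fin g) ℤ) : Matrix (Fin g ⊕ Fin g) (Fin g ⊕ Fin g) ℤ) *
          fromBlocks (-1 : Matrix (Fin g) (Fin g) ℤ) 0 0 (1 : Matrix (Fin g) (Fin g) ℤ),
        iStar_mul_mul_iStar_mem_symplecticGroup (a).2⟩ : Matrix.symplecticGroup (Fin g) ℤ)⁻¹ * γ * a : Matrix.symplecticGroup (Fin g) ℤ) : Matrix (Fin g ⊕ Fin g) (Fin g ⊕ Fin g) ℤ).toBlocks₁₂ = 0)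
    (hu₂₁ : (((⟨fromBlocks (-1 : Matrix (Fin g) (Fin g) ℤ) 0 0 (1 : Matrix (Fin g) (Fin g) ℤ) *
          ((a : Matrix.symplecticGroup (Fin g) ℤ) : Matrix (Fin g ⊕ Fin g) (Fin g ⊕ Fin g) ℤ) *
          fromBlocks (-1 : Matrix (Fin g) (Fin g) ℤ) 0 0 (1 : Matrix (Fin g) (Fin g) ℤ),
        iStar_mul_mul_iStar_mem_symplecticGroup (a).2⟩ : Matrix.symplecticGroup (Fin g) ℤ)⁻¹ * γ * a : Matrix.symplecticGroup (Fin g) ℤ) : Matrix (Fin g ⊕ Fin g) (Fin g ⊕ Fin g) ℤ).toBlocks₂₁ = 0) :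
    ((⟨fromBlocks (-1 : Matrix (Fin g) (Fin g) ℤ) 0 0 (1 : Matrix (Fin g) (Fin g) ℤ) *
          ((a : Matrix.symplecticGroup (Fin g) ℤ) : Matrix (Fin g ⊕ Fin g) (Fin g ⊕ Fin g) ℤ) *
          fromBlocks (-1 : Matrix (Fin g) (Fin g) ℤ) 0 0 (1 : Matrix (Fin g) (Fin g) ℤ),
        iStar_mul_mul_iStar_mem_symplecticGroup (a).2⟩ : Matrix.symplecticGroup (Fin g) ℤ)⁻¹ * γ * a) * ((⟨fromBlocks (-1 : Matrix (Fin g) (Fin g) ℤ) 0 0 (1 : Matrix (Fin g) (Fin g) ℤ) *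
          ((a : Matrix.symplecticGroup (Fin g) ℤ) : Matrix (Fin g ⊕ Fin g) (Fin g ⊕ Fin g) ℤ) *
          fromBlocks (-1 : Matrix (Fin g) (Fin g) ℤ) 0 0 (1 : Matrix (Fin g) (Fin g) ℤ),
        iStar_mul_mul_iStar_mem_symplecticGroup (a).2⟩ : Matrix.symplecticGroup (Fin g) ℤ)⁻¹ * γ * a) ∈ siegelPrincipalGamma g (4 * m) := by
  have h := conjK_mk_mul_self_mem_siegelPrincipalGamma_of_eq_conjK_inv_mul_mul hγ a
  rwa [conjK_mk_eq_self_of_toBlocks_eq_zero _ hu₁₂ hu₂₁] at h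

end Tau

/-! ## §2 Lemma 27 assembled: `g = ah`, `τ(g)⁻¹γ′g = h⁻¹uh ≡ diag(ε) ⊕ diag(ε) (mod 2^k)` -/

section Lemma27

/-- **Goresky–Tai 2003, Lemma 27 — the algebra of §10.2 assembled.**  Let `k ≥ 1`, `γ′ ∈ Γ_g(2^k)` and
`a ∈ Sp_{2g}(ℤ)` be such that `u = τ(a)⁻¹γ′a` («`u = ã⁻¹γ′a = (A 0; 0 ᵗA⁻¹) ∈ ker(ν)`», the output of Proposition 23)
is block-diagonal with identity rows on `S` («`A = (I_q 0; * *)`»).  Then («`γ̃′γ′ = au²a⁻¹ ∈ Γ(2^{k+1})` by Lemma 9,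
hence `A² ≡ I mod 2^{k+1}`.  Moreover, `A ∈ Γ(2)` … Let `p` be the change of basis provided by Lemma 26 … Set
`h = (p 0; 0 ᵗp⁻¹) ∈ ker(ν)`.  Set `g = ah`. … Then `h̃⁻¹uh = g̃⁻¹γ′g ∈ ker(ν)` and `g̃⁻¹γ′g` has the desired form (10.2)»)
there are a block-diagonal `h ∈ Sp_{2g}(ℤ)` with identity rows on `S` and `τ(h) = h`, and signs `ε ∈ {±1}^g` with
`ε = 1` on `S`, such that `τ(ah)⁻¹γ′(ah) = h⁻¹uh ≡ (diag ε 0; 0 diag ε) (mod 2^k)` — (10.2) up to the order of the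
coordinates (GT: `diag(I_r, −I_s, I_r, −I_s)`, `r ≥ q`; the re-ordering permutation is not asserted).
[cite: GoreskyTai2003RealModuli, §10.1 Lemma 27 and §10.2 (its proof)] -/
theorem exists_blockDiagonal_conjK_inv_mul_mul_map_eq_of_mem_siegelPrincipalGamma {k : ℕ} (hk : 1 ≤ k)
    (S : Finset (Fin g)) {γ : Matrix.symplecticGroup (Fin g) ℤ} (hγ : γ ∈ siegelPrincipalGamma g (2 ^ k)) (a : Matrix.symplecticGroup (Fin g) ℤ)
    (hu₁₂ : (((⟨fromBlocks (-1 : Matrix (Fin g) (Fin g) ℤ) 0 0 (1 : Matrix (Fin g) (Fin g) ℤ) *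
          ((a : Matrix.symplecticGroup (Fin g) ℤ) : Matrix (Fin g ⊕ Fin g) (Fin g ⊕ Fin g) ℤ) *
          fromBlocks (-1 : Matrix (Fin g) (Fin g) ℤ) 0 0 (1 : Matrix (Fin g) (Fin g) ℤ),
        iStar_mul_mul_iStar_mem_symplecticGroup (a).2⟩ : Matrix.symplecticGroup (Fin g) ℤ)⁻¹ * γ * a : Matrix.symplecticGroup (Fin g) ℤ) : Matrix (Fin g ⊕ Fin g) (Fin g ⊕ Fin g) ℤ).toBlocks₁₂ = 0)
    (hu₂₁ : (((⟨fromBlocks (-1 : Matrix (Fin g) (Fin g) ℤ) 0 0 (1 : Matrix (Fin g) (Fin g) ℤ) *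
          ((a : Matrix.symplecticGroup (Fin g) ℤ) : Matrix (Fin g ⊕ Fin g) (Fin g ⊕ Fin g) ℤ) *
          fromBlocks (-1 : Matrix (Fin g) (Fin g) ℤ) 0 0 (1 : Matrix (Fin g) (Fin g) ℤ),
        iStar_mul_mul_iStar_mem_symplecticGroup (a).2⟩ : Matrix.symplecticGroup (Fin g) ℤ)⁻¹ * γ * a : Matrix.symplecticGroup (Fin g) ℤ) : Matrix (Fin g ⊕ Fin g) (Fin g ⊕ Fin g) ℤ).toBlocks₂₁ = 0)
    (hS : ∀ i ∈ S, ∀ j, (((⟨fromBlocks (-1 : Matrix (Fin g) (Fin g) ℤ) 0 0 (1 : Matrix (Fin g) (Fin g) ℤ) *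
          ((a : Matrix.symplecticGroup (Fin g) ℤ) : Matrix (Fin g ⊕ Fin g) (Fin g ⊕ Fin g) ℤ) *
          fromBlocks (-1 : Matrix (Fin g) (Fin g) ℤ) 0 0 (1 : Matrix (Fin g) (Fin g) ℤ),
        iStar_mul_mul_iStar_mem_symplecticGroup (a).2⟩ : Matrix.symplecticGroup (Fin g) ℤ)⁻¹ * γ * a : Matrix.symplecticGroup (Fin g) ℤ) : Matrix (Fin g ⊕ Fin g) (Fin g ⊕ Fin g) ℤ).toBlocks₁₁ i j = (1 : Matrix (Fin g) (Fin g) ℤ) i j) :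
    ∃ h : Matrix.symplecticGroup (Fin g) ℤ,
      (h : Matrix (Fin g ⊕ Fin g) (Fin g ⊕ Fin g) ℤ).toBlocks₁₂ = 0 ∧ (h : Matrix (Fin g ⊕ Fin g) (Fin g ⊕ Fin g) ℤ).toBlocks₂₁ = 0 ∧
      (∀ i ∈ S, ∀ j, (h : Matrix (Fin g ⊕ Fin g) (Fin g ⊕ Fin g) ℤ).toBlocks₁₁ i j = (1 : Matrix (Fin g) (Fin g) ℤ) i j) ∧
      (⟨fromBlocks (-1 : Matrix (Fin g) (Fin g) ℤ) 0 0 (1 : Matrix (Fin g) (Fin g) ℤ) *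
          ((h : Matrix.symplecticGroup (Fin g) ℤ) : Matrix (Fin g ⊕ Fin g) (Fin g ⊕ Fin g) ℤ) *
          fromBlocks (-1 : Matrix (Fin g) (Fin g) ℤ) 0 0 (1 : Matrix (Fin g) (Fin g) ℤ),
        iStar_mul_mul_iStar_mem_symplecticGroup (h).2⟩ : Matrix.symplecticGroup (Fin g) ℤ) = h ∧
      ∃ ε : Fin g → ℤ, (∀ i, ε i = 1 ∨ ε i = -1) ∧ (∀ i ∈ S, ε i = 1) ∧
        (⟨fromBlocks (-1 : Matrix (Fin g) (Fin g) ℤ) 0 0 (1 : Matrix (Fin g) (Fin g) ℤ) *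
          ((a * h : Matrix.symplecticGroup (Fin g) ℤ) : Matrix (Fin g ⊕ Fin g) (Fin g ⊕ Fin g) ℤ) *
          fromBlocks (-1 : Matrix (Fin g) (Fin g) ℤ) 0 0 (1 : Matrix (Fin g) (Fin g) ℤ),
        iStar_mul_mul_iStar_mem_symplecticGroup (a * h).2⟩ : Matrix.symplecticGroup (Fin g) ℤ)⁻¹ * γ * (a * h) = h⁻¹ * ((⟨fromBlocks (-1 : Matrix (Fin g) (Fin g) ℤ) 0 0 (1 : Matrix (Fin g) (Fin g) ℤ) *
          ((a : Matrix.symplecticGroup (Fin g) ℤ) : Matrix (Fin g ⊕ Fin g) (Fin g ⊕ Fin g) ℤ) *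
          fromBlocks (-1 : Matrix (Fin g) (Fin g) ℤ) 0 0 (1 : Matrix (Fin g) (Fin g) ℤ),
        iStar_mul_mul_iStar_mem_symplecticGroup (a).2⟩ : Matrix.symplecticGroup (Fin g) ℤ)⁻¹ * γ * a) * h ∧
        (((⟨fromBlocks (-1 : Matrix (Fin g) (Fin g) ℤ) 0 0 (1 : Matrix (Fin g) (Fin g) ℤ) *
          ((a * h : Matrix.symplecticGroup (Fin g) ℤ) : Matrix (Fin g ⊕ Fin g) (Fin g ⊕ Fin g) ℤ) *
          fromBlocks (-1 : Matrix (Fin g) (Fin g) ℤ) 0 0 (1 : Matrix (Fin g) (Fin g) ℤ),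
        iStar_mul_mul_iStar_mem_symplecticGroup (a * h).2⟩ : Matrix.symplecticGroup (Fin g) ℤ)⁻¹ * γ * (a * h) : Matrix.symplecticGroup (Fin g) ℤ) : Matrix (Fin g ⊕ Fin g) (Fin g ⊕ Fin g) ℤ).map (Int.castRingHom (ZMod (2 ^ k))) =
          fromBlocks (diagonal fun i => (ε i : ZMod (2 ^ k))) 0 0 (diagonal fun i => (ε i : ZMod (2 ^ k))) := by
  obtain ⟨k, rfl⟩ := Nat.exists_eq_add_of_le' hk
  have h2 : (⟨fromBlocks (-1 : Matrix (Fin g) (Fin g) ℤ) 0 0 (1 : Matrix (Fin g) (Fin g) ℤ) *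
          ((a : Matrix.symplecticGroup (Fin g) ℤ) : Matrix (Fin g ⊕ Fin g) (Fin g ⊕ Fin g) ℤ) *
          fromBlocks (-1 : Matrix (Fin g) (Fin g) ℤ) 0 0 (1 : Matrix (Fin g) (Fin g) ℤ),
        iStar_mul_mul_iStar_mem_symplecticGroup (a).2⟩ : Matrix.symplecticGroup (Fin g) ℤ)⁻¹ * γ * a ∈ siegelPrincipalGamma g 2 :=
    conjK_inv_mul_mul_mem_siegelPrincipalGamma_two
      (siegelPrincipalGamma_anti (dvd_pow_self 2 (Nat.succ_ne_zero k)) hγ) a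
  have hγ' : γ ∈ siegelPrincipalGamma g (2 * 2 ^ k) := by rwa [← pow_succ']
  have hsq : ((⟨fromBlocks (-1 : Matrix (Fin g) (Fin g) ℤ) 0 0 (1 : Matrix (Fin g) (Fin g) ℤ) *
          ((a : Matrix.symplecticGroup (Fin g) ℤ) : Matrix (Fin g ⊕ Fin g) (Fin g ⊕ Fin g) ℤ) *
          fromBlocks (-1 : Matrix (Fin g) (Fin g) ℤ) 0 0 (1 : Matrix (Fin g) (Fin g) ℤ),
        iStar_mul_mul_iStar_mem_symplecticGroup (a).2⟩ : Matrix.symplecticGroup (Fin g) ℤ)⁻¹ * γ * a) * ((⟨fromBlocks (-1 : Matrix (Fin g) (Fin g) ℤ) 0 0 (1 : Matrix (Fin g) (Fin g) ℤ) *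
          ((a : Matrix.symplecticGroup (Fin g) ℤ) : Matrix (Fin g ⊕ Fin g) (Fin g ⊕ Fin g) ℤ) *
          fromBlocks (-1 : Matrix (Fin g) (Fin g) ℤ) 0 0 (1 : Matrix (Fin g) (Fin g) ℤ),
        iStar_mul_mul_iStar_mem_symplecticGroup (a).2⟩ : Matrix.symplecticGroup (Fin g) ℤ)⁻¹ * γ * a) ∈ siegelPrincipalGamma g (2 ^ (k + 1 + 1)) := by
    rw [show 2 ^ (k + 1 + 1) = 4 * 2 ^ k by ring]
    exact mul_self_mem_siegelPrincipalGamma_of_eq_conjK_inv_mul_mul hγ' a hu₁₂ hu₂₁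
  obtain ⟨h, h₁₂, h₂₁, hhS, ε, hε, hεS, hmap⟩ :=
    exists_blockDiagonal_inv_mul_mul_map_eq_of_mem_siegelPrincipalGamma (k + 1) S _ hu₁₂ hu₂₁ hS h2 hsq
  have hτh : (⟨fromBlocks (-1 : Matrix (Fin g) (Fin g) ℤ) 0 0 (1 : Matrix (Fin g) (Fin g) ℤ) *
          ((h : Matrix.symplecticGroup (Fin g) ℤ) : Matrix (Fin g ⊕ Fin g) (Fin g ⊕ Fin g) ℤ) *
          fromBlocks (-1 : Matrix (Fin g) (Fin g) ℤ) 0 0 (1 : Matrix (Fin g) (Fin g) ℤ),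
        iStar_mul_mul_iStar_mem_symplecticGroup (h).2⟩ : Matrix.symplecticGroup (Fin g) ℤ) = h := conjK_mk_eq_self_of_toBlocks_eq_zero h h₁₂ h₂₁
  have hconj : (⟨fromBlocks (-1 : Matrix (Fin g) (Fin g) ℤ) 0 0 (1 : Matrix (Fin g) (Fin g) ℤ) *
          ((a * h : Matrix.symplecticGroup (Fin g) ℤ) : Matrix (Fin g ⊕ Fin g) (Fin g ⊕ Fin g) ℤ) *
          fromBlocks (-1 : Matrix (Fin g) (Fin g) ℤ) 0 0 (1 : Matrix (Fin g) (Fin g) ℤ),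
        iStar_mul_mul_iStar_mem_symplecticGroup (a * h).2⟩ : Matrix.symplecticGroup (Fin g) ℤ)⁻¹ * γ * (a * h) = h⁻¹ * ((⟨fromBlocks (-1 : Matrix (Fin g) (Fin g) ℤ) 0 0 (1 : Matrix (Fin g) (Fin g) ℤ) *
          ((a : Matrix.symplecticGroup (Fin g) ℤ) : Matrix (Fin g ⊕ Fin g) (Fin g ⊕ Fin g) ℤ) *
          fromBlocks (-1 : Matrix (Fin g) (Fin g) ℤ) 0 0 (1 : Matrix (Fin g) (Fin g) ℤ),
        iStar_mul_mul_iStar_mem_symplecticGroup (a).2⟩ : Matrix.symplecticGroup (Fin g) ℤ)⁻¹ * γ * a) * h := by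
    rw [conjK_mk_mul, hτh]
    group
  refine ⟨h, h₁₂, h₂₁, hhS, hτh, ε, hε, hεS, hconj, ?_⟩
  rw [hconj]
  exact hmap

end Lemma27

/-! ## §3 Theorem 28 assembled: `j u j ∈ Γ_g(2^k)` and the cocycle `ω = τ(gj)(gj)⁻¹ ∈ Γ_g(2^k)` of Proposition 24 -/

section Theorem28

/-- **`τ(j) = j⁻¹` in the group `Sp_{2g}(ℤ)`** for `j = j(ε)` («`j̃_r = j_r⁻¹`»).
[cite: GoreskyTai2003RealModuli, §8.3 («Then `j̃_r = j_r⁻¹`»)] -/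
theorem conjK_mk_jSign_eq_inv (ε : Fin g → ℤ) : (⟨fromBlocks (-1 : Matrix (Fin g) (Fin g) ℤ) 0 0 (1 : Matrix (Fin g) (Fin g) ℤ) *
          (((⟨fromBlocks (diagonal fun i => if ε i = 1 then (1 : ℤ) else 0) (diagonal fun i => if ε i = 1 then (0 : ℤ) else 1)
          (-diagonal fun i => if ε i = 1 then (0 : ℤ) else 1) (diagonal fun i => if ε i = 1 then (1 : ℤ) else 0),
        jSign_mem_symplecticGroup ε⟩ : Matrix.symplecticGroup (Fin g) ℤ) : Matrix.symplecticGroup (Fin g) ℤ) : Matrix (Fin g ⊕ Fin g) (Fin g ⊕ Fin g) ℤ) *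
          fromBlocks (-1 : Matrix (Fin g) (Fin g) ℤ) 0 0 (1 : Matrix (Fin g) (Fin g) ℤ),
        iStar_mul_mul_iStar_mem_symplecticGroup ((⟨fromBlocks (diagonal fun i => if ε i = 1 then (1 : ℤ) else 0) (diagonal fun i => if ε i = 1 then (0 : ℤ) else 1)
          (-diagonal fun i => if ε i = 1 then (0 : ℤ) else 1) (diagonal fun i => if ε i = 1 then (1 : ℤ) else 0),
        jSign_mem_symplecticGroup ε⟩ : Matrix.symplecticGroup (Fin g) ℤ)).2⟩ : Matrix.symplecticGroup (Fin g) ℤ) = ((⟨fromBlocks (diagonal fun i => if ε i = 1 then (1 : ℤ) else 0) (diagonal fun i => if ε i = 1 then (0 : ℤ) else 1)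
          (-diagonal fun i => if ε i = 1 then (0 : ℤ) else 1) (diagonal fun i => if ε i = 1 then (1 : ℤ) else 0),
        jSign_mem_symplecticGroup ε⟩ : Matrix.symplecticGroup (Fin g) ℤ))⁻¹ := by
  apply eq_inv_of_mul_eq_one_left
  rw [Subtype.ext_iff, Submonoid.coe_mul, OneMemClass.coe_one]
  exact iStar_mul_jSign_mul_iStar_mul_jSign ε

/-- **Goresky–Tai 2003, Theorem 28 — the algebra of §10.3 and §8.4 assembled.**  In the situation of Lemma 27
(`k ≥ 1`, `γ′ ∈ Γ_g(2^k)`, `u = τ(a)⁻¹γ′a` block-diagonal with identity rows on `S`), with the block-diagonal `h`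
(`τ(h) = h`, identity rows on `S`), the signs `ε` (`= 1` on `S`) and `g = ah` of Lemma 27 and with `j = j(ε)`
(`τ(j) = j⁻¹`): «`u = g̃⁻¹γ₁g` lies in `ker(ν)` and has the form (10.2) … Therefore `j_ruj_r ≡ I mod 2^k` so
Proposition 24 may be applied» — i.e. (i) `j·(τ(g)⁻¹γ′g)·j ∈ Γ_g(2^k)`, and Proposition 24's conclusion at group level
(§8.4: «`ω = τ(gj_r)(gj_r)⁻¹ = γ((gj_r)(j_ruj_r)⁻¹(gj_r)⁻¹) ∈ Γ(4m)`»): (ii) the identity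
`ω = τ(gj)(gj)⁻¹ = γ′·((gj)(j(τ(g)⁻¹γ′g)j)⁻¹(gj)⁻¹)` and (iii) `ω ∈ Γ_g(2^k)`.  (The geometric conclusion
`F^{γ′} ⊂ closure(𝔥_n^{ω})` of Proposition 24 / Theorem 28 is not formalized here.)
[cite: GoreskyTai2003RealModuli, §10.1 Theorem 28, §10.3 (its proof) and §8.4 (proof of Proposition 24)] -/
theorem exists_blockDiagonal_jSign_conj_mem_and_cocycle_mem_siegelPrincipalGamma {k : ℕ} (hk : 1 ≤ k)
    (S : Finset (Fin g)) {γ : Matrix.symplecticGroup (Fin g) ℤ} (hγ : γ ∈ siegelPrincipalGamma g (2 ^ k)) (a : Matrix.symplecticGroup (Fin g) ℤ)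
    (hu₁₂ : (((⟨fromBlocks (-1 : Matrix (Fin g) (Fin g) ℤ) 0 0 (1 : Matrix (Fin g) (Fin g) ℤ) *
          ((a : Matrix.symplecticGroup (Fin g) ℤ) : Matrix (Fin g ⊕ Fin g) (Fin g ⊕ Fin g) ℤ) *
          fromBlocks (-1 : Matrix (Fin g) (Fin g) ℤ) 0 0 (1 : Matrix (Fin g) (Fin g) ℤ),
        iStar_mul_mul_iStar_mem_symplecticGroup (a).2⟩ : Matrix.symplecticGroup (Fin g) ℤ)⁻¹ * γ * a : Matrix.symplecticGroup (Fin g) ℤ) : Matrix (Fin g ⊕ Fin g) (Fin g ⊕ Fin g) ℤ).toBlocks₁₂ = 0)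
    (hu₂₁ : (((⟨fromBlocks (-1 : Matrix (Fin g) (Fin g) ℤ) 0 0 (1 : Matrix (Fin g) (Fin g) ℤ) *
          ((a : Matrix.symplecticGroup (Fin g) ℤ) : Matrix (Fin g ⊕ Fin g) (Fin g ⊕ Fin g) ℤ) *
          fromBlocks (-1 : Matrix (Fin g) (Fin g) ℤ) 0 0 (1 : Matrix (Fin g) (Fin g) ℤ),
        iStar_mul_mul_iStar_mem_symplecticGroup (a).2⟩ : Matrix.symplecticGroup (Fin g) ℤ)⁻¹ * γ * a : Matrix.symplecticGroup (Fin g) ℤ) : Matrix (Fin g ⊕ Fin g) (Fin g ⊕ Fin g) ℤ).toBlocks₂₁ = 0)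
    (hS : ∀ i ∈ S, ∀ j, (((⟨fromBlocks (-1 : Matrix (Fin g) (Fin g) ℤ) 0 0 (1 : Matrix (Fin g) (Fin g) ℤ) *
          ((a : Matrix.symplecticGroup (Fin g) ℤ) : Matrix (Fin g ⊕ Fin g) (Fin g ⊕ Fin g) ℤ) *
          fromBlocks (-1 : Matrix (Fin g) (Fin g) ℤ) 0 0 (1 : Matrix (Fin g) (Fin g) ℤ),
        iStar_mul_mul_iStar_mem_symplecticGroup (a).2⟩ : Matrix.symplecticGroup (Fin g) ℤ)⁻¹ * γ * a : Matrix.symplecticGroup (Fin g) ℤ) : Matrix (Fin g ⊕ Fin g) (Fin g ⊕ Fin g) ℤ).toBlocks₁₁ i j = (1 : Matrix (Fin g) (Fin g) ℤ) i j) :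
    ∃ h : Matrix.symplecticGroup (Fin g) ℤ,
      (h : Matrix (Fin g ⊕ Fin g) (Fin g ⊕ Fin g) ℤ).toBlocks₁₂ = 0 ∧ (h : Matrix (Fin g ⊕ Fin g) (Fin g ⊕ Fin g) ℤ).toBlocks₂₁ = 0 ∧
      (∀ i ∈ S, ∀ j, (h : Matrix (Fin g ⊕ Fin g) (Fin g ⊕ Fin g) ℤ).toBlocks₁₁ i j = (1 : Matrix (Fin g) (Fin g) ℤ) i j) ∧
      (⟨fromBlocks (-1 : Matrix (Fin g) (Fin g) ℤ) 0 0 (1 : Matrix (Fin g) (Fin g) ℤ) *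
          ((h : Matrix.symplecticGroup (Fin g) ℤ) : Matrix (Fin g ⊕ Fin g) (Fin g ⊕ Fin g) ℤ) *
          fromBlocks (-1 : Matrix (Fin g) (Fin g) ℤ) 0 0 (1 : Matrix (Fin g) (Fin g) ℤ),
        iStar_mul_mul_iStar_mem_symplecticGroup (h).2⟩ : Matrix.symplecticGroup (Fin g) ℤ) = h ∧
      ∃ ε : Fin g → ℤ, (∀ i, ε i = 1 ∨ ε i = -1) ∧ (∀ i ∈ S, ε i = 1) ∧
        (((⟨fromBlocks (-1 : Matrix (Fin g) (Fin g) ℤ) 0 0 (1 : Matrix (Fin g) (Fin g) ℤ) *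
          ((a * h : Matrix.symplecticGroup (Fin g) ℤ) : Matrix (Fin g ⊕ Fin g) (Fin g ⊕ Fin g) ℤ) *
          fromBlocks (-1 : Matrix (Fin g) (Fin g) ℤ) 0 0 (1 : Matrix (Fin g) (Fin g) ℤ),
        iStar_mul_mul_iStar_mem_symplecticGroup (a * h).2⟩ : Matrix.symplecticGroup (Fin g) ℤ)⁻¹ * γ * (a * h) : Matrix.symplecticGroup (Fin g) ℤ) : Matrix (Fin g ⊕ Fin g) (Fin g ⊕ Fin g) ℤ).map (Int.castRingHom (ZMod (2 ^ k))) =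
          fromBlocks (diagonal fun i => (ε i : ZMod (2 ^ k))) 0 0 (diagonal fun i => (ε i : ZMod (2 ^ k))) ∧
        (⟨fromBlocks (diagonal fun i => if ε i = 1 then (1 : ℤ) else 0) (diagonal fun i => if ε i = 1 then (0 : ℤ) else 1)
          (-diagonal fun i => if ε i = 1 then (0 : ℤ) else 1) (diagonal fun i => if ε i = 1 then (1 : ℤ) else 0),
        jSign_mem_symplecticGroup ε⟩ : Matrix.symplecticGroup (Fin g) ℤ) * ((⟨fromBlocks (-1 : Matrix (Fin g) (Fin g) ℤ) 0 0 (1 : Matrix (Fin g) (Fin g) ℤ) *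
          ((a * h : Matrix.symplecticGroup (Fin g) ℤ) : Matrix (Fin g ⊕ Fin g) (Fin g ⊕ Fin g) ℤ) *
          fromBlocks (-1 : Matrix (Fin g) (Fin g) ℤ) 0 0 (1 : Matrix (Fin g) (Fin g) ℤ),
        iStar_mul_mul_iStar_mem_symplecticGroup (a * h).2⟩ : Matrix.symplecticGroup (Fin g) ℤ)⁻¹ * γ * (a * h)) * (⟨fromBlocks (diagonal fun i => if ε i = 1 then (1 : ℤ) else 0) (diagonal fun i => if ε i = 1 then (0 : ℤ) else 1)
          (-diagonal fun i => if ε i = 1 then (0 : ℤ) else 1) (diagonal fun i => if ε i = 1 then (1 : ℤ) else 0),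
        jSign_mem_symplecticGroup ε⟩ : Matrix.symplecticGroup (Fin g) ℤ) ∈ siegelPrincipalGamma g (2 ^ k) ∧
        (⟨fromBlocks (-1 : Matrix (Fin g) (Fin g) ℤ) 0 0 (1 : Matrix (Fin g) (Fin g) ℤ) *
          ((a * h * (⟨fromBlocks (diagonal fun i => if ε i = 1 then (1 : ℤ) else 0) (diagonal fun i => if ε i = 1 then (0 : ℤ) else 1)
          (-diagonal fun i => if ε i = 1 then (0 : ℤ) else 1) (diagonal fun i => if ε i = 1 then (1 : ℤ) else 0),
        jSign_mem_symplecticGroup ε⟩ : Matrix.symplecticGroup (Fin g) ℤ) : Matrix.symplecticGroup (Fin g) ℤ) : Matrix (Fin g ⊕ Fin g) (Fin g ⊕ Fin g) ℤ) *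
          fromBlocks (-1 : Matrix (Fin g) (Fin g) ℤ) 0 0 (1 : Matrix (Fin g) (Fin g) ℤ),
        iStar_mul_mul_iStar_mem_symplecticGroup (a * h * (⟨fromBlocks (diagonal fun i => if ε i = 1 then (1 : ℤ) else 0) (diagonal fun i => if ε i = 1 then (0 : ℤ) else 1)
          (-diagonal fun i => if ε i = 1 then (0 : ℤ) else 1) (diagonal fun i => if ε i = 1 then (1 : ℤ) else 0),
        jSign_mem_symplecticGroup ε⟩ : Matrix.symplecticGroup (Fin g) ℤ)).2⟩ : Matrix.symplecticGroup (Fin g) ℤ) * (a * h * (⟨fromBlocks (diagonal fun i => if ε i = 1 then (1 : ℤ) else 0) (diagonal fun i => if ε i = 1 then (0 : ℤ) else 1)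
          (-diagonal fun i => if ε i = 1 then (0 : ℤ) else 1) (diagonal fun i => if ε i = 1 then (1 : ℤ) else 0),
        jSign_mem_symplecticGroup ε⟩ : Matrix.symplecticGroup (Fin g) ℤ))⁻¹ =
          γ * ((a * h * (⟨fromBlocks (diagonal fun i => if ε i = 1 then (1 : ℤ) else 0) (diagonal fun i => if ε i = 1 then (0 : ℤ) else 1)
          (-diagonal fun i => if ε i = 1 then (0 : ℤ) else 1) (diagonal fun i => if ε i = 1 then (1 : ℤ) else 0),
        jSign_mem_symplecticGroup ε⟩ : Matrix.symplecticGroup (Fin g) ℤ)) * ((⟨fromBlocks (diagonal fun i => if ε i = 1 then (1 : ℤ) else 0) (diagonal fun i => if ε i = 1 then (0 : ℤ) else 1)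
          (-diagonal fun i => if ε i = 1 then (0 : ℤ) else 1) (diagonal fun i => if ε i = 1 then (1 : ℤ) else 0),
        jSign_mem_symplecticGroup ε⟩ : Matrix.symplecticGroup (Fin g) ℤ) * ((⟨fromBlocks (-1 : Matrix (Fin g) (Fin g) ℤ) 0 0 (1 : Matrix (Fin g) (Fin g) ℤ) *
          ((a * h : Matrix.symplecticGroup (Fin g) ℤ) : Matrix (Fin g ⊕ Fin g) (Fin g ⊕ Fin g) ℤ) *
          fromBlocks (-1 : Matrix (Fin g) (Fin g) ℤ) 0 0 (1 : Matrix (Fin g) (Fin g) ℤ),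
        iStar_mul_mul_iStar_mem_symplecticGroup (a * h).2⟩ : Matrix.symplecticGroup (Fin g) ℤ)⁻¹ * γ * (a * h)) * (⟨fromBlocks (diagonal fun i => if ε i = 1 then (1 : ℤ) else 0) (diagonal fun i => if ε i = 1 then (0 : ℤ) else 1)
          (-diagonal fun i => if ε i = 1 then (0 : ℤ) else 1) (diagonal fun i => if ε i = 1 then (1 : ℤ) else 0),
        jSign_mem_symplecticGroup ε⟩ : Matrix.symplecticGroup (Fin g) ℤ))⁻¹ * (a * h * (⟨fromBlocks (diagonal fun i => if ε i = 1 then (1 : ℤ) else 0) (diagonal fun i => if ε i = 1 then (0 : ℤ) else 1)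
          (-diagonal fun i => if ε i = 1 then (0 : ℤ) else 1) (diagonal fun i => if ε i = 1 then (1 : ℤ) else 0),
        jSign_mem_symplecticGroup ε⟩ : Matrix.symplecticGroup (Fin g) ℤ))⁻¹) ∧
        (⟨fromBlocks (-1 : Matrix (Fin g) (Fin g) ℤ) 0 0 (1 : Matrix (Fin g) (Fin g) ℤ) *
          ((a * h * (⟨fromBlocks (diagonal fun i => if ε i = 1 then (1 : ℤ) else 0) (diagonal fun i => if ε i = 1 then (0 : ℤ) else 1)
          (-diagonal fun i => if ε i = 1 then (0 : ℤ) else 1) (diagonal fun i => if ε i = 1 then (1 : ℤ) else 0),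
        jSign_mem_symplecticGroup ε⟩ : Matrix.symplecticGroup (Fin g) ℤ) : Matrix.symplecticGroup (Fin g) ℤ) : Matrix (Fin g ⊕ Fin g) (Fin g ⊕ Fin g) ℤ) *
          fromBlocks (-1 : Matrix (Fin g) (Fin g) ℤ) 0 0 (1 : Matrix (Fin g) (Fin g) ℤ),
        iStar_mul_mul_iStar_mem_symplecticGroup (a * h * (⟨fromBlocks (diagonal fun i => if ε i = 1 then (1 : ℤ) else 0) (diagonal fun i => if ε i = 1 then (0 : ℤ) else 1)
          (-diagonal fun i => if ε i = 1 then (0 : ℤ) else 1) (diagonal fun i => if ε i = 1 then (1 : ℤ) else 0),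
        jSign_mem_symplecticGroup ε⟩ : Matrix.symplecticGroup (Fin g) ℤ)).2⟩ : Matrix.symplecticGroup (Fin g) ℤ) * (a * h * (⟨fromBlocks (diagonal fun i => if ε i = 1 then (1 : ℤ) else 0) (diagonal fun i => if ε i = 1 then (0 : ℤ) else 1)
          (-diagonal fun i => if ε i = 1 then (0 : ℤ) else 1) (diagonal fun i => if ε i = 1 then (1 : ℤ) else 0),
        jSign_mem_symplecticGroup ε⟩ : Matrix.symplecticGroup (Fin g) ℤ))⁻¹ ∈ siegelPrincipalGamma g (2 ^ k) := by
  obtain ⟨h, h₁₂, h₂₁, hhS, hτh, ε, hε, hεS, -, hmap⟩ :=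
    exists_blockDiagonal_conjK_inv_mul_mul_map_eq_of_mem_siegelPrincipalGamma hk S hγ a hu₁₂ hu₂₁ hS
  have hj := jSign_mul_mul_jSign_mem_siegelPrincipalGamma hε _ hmap
  obtain ⟨hid, hω⟩ :=
    iStarConj_mul_inv_eq_and_mem_siegelPrincipalGamma (2 ^ k) γ (a * h) (⟨fromBlocks (diagonal fun i => if ε i = 1 then (1 : ℤ) else 0) (diagonal fun i => if ε i = 1 then (0 : ℤ) else 1)
          (-diagonal fun i => if ε i = 1 then (0 : ℤ) else 1) (diagonal fun i => if ε i = 1 then (1 : ℤ) else 0),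
        jSign_mem_symplecticGroup ε⟩ : Matrix.symplecticGroup (Fin g) ℤ) (conjK_mk_jSign_eq_inv ε) hγ hj
  exact ⟨h, h₁₂, h₂₁, hhS, hτh, ε, hε, hεS, hmap, hj, hid, hω⟩

end Theorem28

end SiegelModuli

end Literature.AlgebraicGeometry.ModuliOfAbelianVarieties
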